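import Summits.AtomisticToContinuum.HydrodynamicLimit.Theorems.MourreKoopmanChargesStressStrongMixingGibbsMoments
import Literature.Analysis.FunctionSpaces.PointConfigVagueTopology
import Literature.Probability.Moments.CovarianceFreezing
import HarnessLib

/-!
# `StressStrongMixing` · line `birth`, stub F3b `stub_twoTimeClustering`:
# reduction of the two-time clustering of the generators to a decay estimate at spatial infinity

Support file for the crux item stmt-AtomisticToContinuum-9584 (`StressStrongMixing`, route `MourreKoopmanCharges` of
`AtomisticToContinuum/HydrodynamicLimit`), line `birth`, registered stub `stub_twoTimeClustering` (F3b):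

  `∃ σ₃ > 0, ∀ σ ∈ (0, σ₃), ∀ Φ equilibrium flow, ∀ θ z > 0, ∀ μ` translation-invariant density-one hard-sphere
  Gibbs state at `(σ, z, θ⁻¹)`, `∀ a b ∈ {five cell charges, cell shear stress}, ∀ t,`
  `Integrable (x ↦ Cov_μ(a, (b ∘ Φ_t) ∘ τ_x))`.

The stub itself (space–time clustering of the dilute hard-sphere gas under Alexander's dynamics, Spohn 1991 Part I
§7.1 (7.6)/(7.14)) is NOT proved here: at `t ≠ 0` it needs locality in law of the infinite dynamics, which the tree
does not assert of any `InfiniteHardSphereFlow` (`HasFiniteClustersOn`, `IsTranslationCovariant` are "not asserted of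
Alexander's flow"), and at `t = 0` the integrability of the truncated pair correlations of the low-activity Gibbs
state (Ruelle 1969 §4.2), available in the tree only for EVENTS under the FREE finite-volume distribution
(`abs_measureReal_inter_sub_mul_le`).  What IS proved here is the complete measure-theoretic reduction of the stub
to its analytic core, a decay (or tail-integrability) estimate of the truncated two-point function at spatial
infinity:

* `measurable_cov_comp_spatialShift`: for measurable `a, B`, the truncated two-point function
  `x ↦ Cov_μ(a, B ∘ τ_x)` is (Borel) measurable on `ℝ³` — the shift action is jointly measurable
  (`PointConfig.measurable_translate_prod`) and parametric Bochner integrals of jointly measurable integrands are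
  measurable (`StronglyMeasurable.integral_prod_right`); no integrability is needed;
* `abs_cov_comp_spatialShift_le`: under shift invariance, `|Cov_μ(a, B ∘ τ_x)| ≤ (Var a · Var B)^{1/2}` uniformly in
  `x` (Cauchy–Schwarz), so the two-point function is integrable on every set of finite volume
  (`integrableOn_cov_comp_spatialShift`);
* `integrable_cov_comp_spatialShift_iff`: hence it is integrable on `ℝ³` iff it is integrable off some closed ball,
  and (`integrable_cov_comp_spatialShift_of_decay`) it is integrable as soon as it is dominated off a ball by an
  integrable function;
* `integrable_cov_flow_spatialShift_of_decay`, `twoTimeClustering_of_decay`: the same with `B = b ∘ Φ_t` for a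
  stationary flow (`b ∘ Φ_t ∈ L²` by stationarity), and for the six generators under a hard-sphere Gibbs state
  (`memLp_generators_of_isHardSphereGibbs`): the registered signature of `stub_twoTimeClustering` follows VERBATIM
  from the existence, for each `(σ, Φ, θ, z, μ, a, b, t)` in its range, of an integrable majorant of
  `|Cov_μ(a, (b ∘ Φ_t) ∘ τ_x)|` off a ball; `integrable_cov_generators_iff_tail` is the tail form;
* `cov_flow_zero_spatialShift`, `integrable_cov_flow_zero_spatialShift_iff`: at `t = 0` the integrand is the static
  truncated two-point function `Cov_μ(a, b ∘ τ_x)` (`Φ_0 = id` a.e.), so the equal-time instance is a property of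
  the Gibbs state alone (Ruelle's static clustering).

References: H. Spohn, *Large Scale Dynamics of Interacting Particles* (1991), Part I §7.1 (7.4)–(7.7), (7.14);
D. Ruelle, *Statistical Mechanics* (1969), §4.2; R. Alexander, Comm. Math. Phys. 49 (1976), Thm 5.2.
-/

noncomputable section

open MeasureTheory ProbabilityTheory Filter Topology
open scoped InnerProductSpace ENNReal

namespace Summit.AtomisticToContinuum.HydrodynamicLimit.Theorems.MourreKoopmanChargesStressStrongMixing

open Literature.MathematicalPhysics.KineticTheory Literature.Analysis.FluidPDE
open Literature.Analysis.FunctionSpaces (PointConfig)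

/-! ### Measurability of the truncated two-point function in the shift parameter -/

/-- The spatial shift action `(x, ω) ↦ τ_x ω` is jointly measurable. [folklore] -/
theorem measurable_spatialShift_uncurry :
    Measurable fun p : V3 × MarkedConfig => spatialShift p.1 p.2 := by
  have hv : Measurable fun p : V3 × MarkedConfig => ((p.1, (0 : V3)) : V3 × V3) :=
    measurable_fst.prodMk measurable_const
  have h : Measurable fun p : V3 × MarkedConfig => (p.2).translate ((p.1, (0 : V3)) : V3 × V3) :=
    Measurable.pointConfig_translate hv measurable_snd
  simpa only [spatialShift_apply] using h

/-- A parametric Bochner integral of a jointly measurable real integrand is measurable in the parameter.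
[folklore] -/
theorem measurable_integral_of_measurable_uncurry {μ : Measure MarkedConfig} [SFinite μ]
    {F : V3 → MarkedConfig → ℝ} (hF : Measurable (Function.uncurry F)) :
    Measurable fun x => ∫ ω, F x ω ∂μ :=
  (hF.stronglyMeasurable.integral_prod_right (ν := μ)).measurable

/-- The mean of a shifted measurable observable is measurable in the shift. [folklore] -/
theorem measurable_integral_comp_spatialShift {μ : Measure MarkedConfig} [SFinite μ]
    {B : MarkedConfig → ℝ} (hB : Measurable B) :
    Measurable fun x : V3 => ∫ ω, (B ∘ spatialShift x) ω ∂μ :=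
  measurable_integral_of_measurable_uncurry (hB.comp measurable_spatialShift_uncurry)

/-- **The truncated two-point function is measurable in the shift**: for measurable `a, B` and any s-finite `μ`,
`x ↦ Cov_μ(a, B ∘ τ_x)` is measurable on `ℝ³` (no integrability hypothesis: the Bochner integral of a
non-integrable function is `0`). [folklore] -/
theorem measurable_cov_comp_spatialShift {μ : Measure MarkedConfig} [SFinite μ]
    {a B : MarkedConfig → ℝ} (ha : Measurable a) (hB : Measurable B) :
    Measurable fun x : V3 => cov[a, B ∘ spatialShift x; μ] := by
  have hm : Measurable fun x : V3 => ∫ ω, (B ∘ spatialShift x) ω ∂μ :=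
    measurable_integral_comp_spatialShift hB
  have hG : Measurable (Function.uncurry fun (x : V3) (ω : MarkedConfig) =>
      (a ω - ∫ ω', a ω' ∂μ) * ((B ∘ spatialShift x) ω - ∫ ω', (B ∘ spatialShift x) ω' ∂μ)) := by
    refine ((ha.comp measurable_snd).sub measurable_const).mul ?_
    exact (hB.comp measurable_spatialShift_uncurry).sub (hm.comp measurable_fst)
  exact measurable_integral_of_measurable_uncurry hG

/-! ### Uniform bound, local integrability, and the reduction to a decay estimate -/

/-- **Cauchy–Schwarz, shift-invariant form**: if the shifts preserve the probability measure `μ`, then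
`|Cov_μ(a, B ∘ τ_x)| ≤ (Var a · Var B)^{1/2}` for every `x`. [folklore] -/
theorem abs_cov_comp_spatialShift_le {μ : Measure MarkedConfig} [IsProbabilityMeasure μ]
    (hshift : ∀ x : V3, MeasurePreserving (spatialShift x) μ μ)
    {a B : MarkedConfig → ℝ} (hB : Measurable B) (ha2 : MemLp a 2 μ) (hB2 : MemLp B 2 μ) (x : V3) :
    |cov[a, B ∘ spatialShift x; μ]| ≤ Real.sqrt (Var[a; μ] * Var[B; μ]) := by
  have hBx : MemLp (B ∘ spatialShift x) 2 μ := hB2.comp_measurePreserving (hshift x)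
  have h1 := Literature.Probability.Moments.covariance_sq_le_variance_mul ha2 hBx
  have hvar : Var[B ∘ spatialShift x; μ] = Var[B; μ] := by
    rw [Function.comp_def]
    exact (hshift x).variance_fun_comp hB.aemeasurable
  rw [hvar] at h1
  calc |cov[a, B ∘ spatialShift x; μ]| = Real.sqrt (cov[a, B ∘ spatialShift x; μ] ^ 2) :=
        (Real.sqrt_sq_eq_abs _).symm
    _ ≤ Real.sqrt (Var[a; μ] * Var[B; μ]) := Real.sqrt_le_sqrt h1

/-- **Local integrability is free**: under shift invariance, for measurable `a, B ∈ L²(μ)` the truncated two-point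
function is integrable on every set of finite volume. [folklore] -/
theorem integrableOn_cov_comp_spatialShift {μ : Measure MarkedConfig} [IsProbabilityMeasure μ]
    (hshift : ∀ x : V3, MeasurePreserving (spatialShift x) μ μ)
    {a B : MarkedConfig → ℝ} (ha : Measurable a) (hB : Measurable B) (ha2 : MemLp a 2 μ) (hB2 : MemLp B 2 μ)
    {K : Set V3} (hKvol : volume K ≠ ∞) :
    IntegrableOn (fun x : V3 => cov[a, B ∘ spatialShift x; μ]) K volume := by
  have hconst : IntegrableOn (fun _ : V3 => Real.sqrt (Var[a; μ] * Var[B; μ])) K volume :=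
    integrableOn_const hKvol
  refine hconst.mono' ((measurable_cov_comp_spatialShift ha hB).aestronglyMeasurable.restrict)
    (Eventually.of_forall fun x => ?_)
  rw [Real.norm_eq_abs]
  exact abs_cov_comp_spatialShift_le hshift hB ha2 hB2 x

/-- **Integrability is a condition at spatial infinity only**: under shift invariance, for measurable
`a, B ∈ L²(μ)` and any radius `R`, `x ↦ Cov_μ(a, B ∘ τ_x)` is integrable on `ℝ³` iff it is integrable off the
closed ball `B̄(0, R)`. [folklore] -/
theorem integrable_cov_comp_spatialShift_iff {μ : Measure MarkedConfig} [IsProbabilityMeasure μ]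
    (hshift : ∀ x : V3, MeasurePreserving (spatialShift x) μ μ)
    {a B : MarkedConfig → ℝ} (ha : Measurable a) (hB : Measurable B) (ha2 : MemLp a 2 μ) (hB2 : MemLp B 2 μ)
    (R : ℝ) :
    Integrable (fun x : V3 => cov[a, B ∘ spatialShift x; μ]) volume ↔
      IntegrableOn (fun x : V3 => cov[a, B ∘ spatialShift x; μ]) (Metric.closedBall (0 : V3) R)ᶜ volume := by
  refine ⟨fun h => h.integrableOn, fun h => ?_⟩
  have hball : IntegrableOn (fun x : V3 => cov[a, B ∘ spatialShift x; μ]) (Metric.closedBall (0 : V3) R) volume :=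
    integrableOn_cov_comp_spatialShift hshift ha hB ha2 hB2 (measure_closedBall_lt_top).ne
  rw [← integrableOn_univ, ← Set.union_compl_self (Metric.closedBall (0 : V3) R)]
  exact hball.union h

/-- **Reduction of spatial integrability to a decay estimate**: under shift invariance, for measurable
`a, B ∈ L²(μ)`, if `|Cov_μ(a, B ∘ τ_x)| ≤ g(x)` for `‖x‖ ≥ R` with `g` integrable, then `x ↦ Cov_μ(a, B ∘ τ_x)` is
integrable on `ℝ³` (measurable by `measurable_cov_comp_spatialShift`, bounded by Cauchy–Schwarz on the ball,
dominated by `g` outside). [folklore] -/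
theorem integrable_cov_comp_spatialShift_of_decay {μ : Measure MarkedConfig} [IsProbabilityMeasure μ]
    (hshift : ∀ x : V3, MeasurePreserving (spatialShift x) μ μ)
    {a B : MarkedConfig → ℝ} (ha : Measurable a) (hB : Measurable B) (ha2 : MemLp a 2 μ) (hB2 : MemLp B 2 μ)
    {g : V3 → ℝ} (hg : Integrable g volume) {R : ℝ}
    (hdecay : ∀ x : V3, R ≤ ‖x‖ → |cov[a, B ∘ spatialShift x; μ]| ≤ g x) :
    Integrable (fun x : V3 => cov[a, B ∘ spatialShift x; μ]) volume := by
  rw [integrable_cov_comp_spatialShift_iff hshift ha hB ha2 hB2 R]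
  refine (hg.abs.integrableOn).mono' ((measurable_cov_comp_spatialShift ha hB).aestronglyMeasurable.restrict) ?_
  rw [ae_restrict_iff' Metric.isClosed_closedBall.measurableSet.compl]
  refine Eventually.of_forall fun x hx => ?_
  have hxR : R ≤ ‖x‖ := by
    rw [Set.mem_compl_iff, Metric.mem_closedBall, dist_zero_right, not_le] at hx
    exact hx.le
  rw [Real.norm_eq_abs]
  exact (hdecay x hxR).trans (le_abs_self _)

/-! ### The flow versions and the reduction of the registered stub -/

/-- **Two-time version**: for a flow `Φ` leaving the shift-invariant probability measure `μ` invariant, measurable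
`a, b ∈ L²(μ)` and a time `t`, the two-time truncated two-point function `x ↦ Cov_μ(a, (b ∘ Φ_t) ∘ τ_x)` is
integrable on `ℝ³` as soon as it is dominated off a ball by an integrable function (`b ∘ Φ_t` is measurable and in
`L²(μ)` by stationarity). [folklore] -/
theorem integrable_cov_flow_spatialShift_of_decay {σ : ℝ} (Φ : InfiniteHardSphereFlow (Fin 3) σ)
    {μ : Measure MarkedConfig} [IsProbabilityMeasure μ] (hS : Φ.IsStationary μ)
    (hshift : ∀ x : V3, MeasurePreserving (spatialShift x) μ μ)
    {a b : MarkedConfig → ℝ} (ha : Measurable a) (hb : Measurable b) (ha2 : MemLp a 2 μ) (hb2 : MemLp b 2 μ)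
    (t : ℝ) {g : V3 → ℝ} (hg : Integrable g volume) {R : ℝ}
    (hdecay : ∀ x : V3, R ≤ ‖x‖ → |cov[a, (b ∘ Φ.flow t) ∘ spatialShift x; μ]| ≤ g x) :
    Integrable (fun x : V3 => cov[a, (b ∘ Φ.flow t) ∘ spatialShift x; μ]) volume :=
  integrable_cov_comp_spatialShift_of_decay hshift ha (hb.comp (Φ.measurable_flow t)) ha2
    (hb2.comp_measurePreserving (hS.measurePreserving t)) hg hdecay

/-- **Two-time version, tail form**: same setting; integrability on `ℝ³` is equivalent to integrability off any one
closed ball. [folklore] -/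
theorem integrable_cov_flow_spatialShift_iff {σ : ℝ} (Φ : InfiniteHardSphereFlow (Fin 3) σ)
    {μ : Measure MarkedConfig} [IsProbabilityMeasure μ] (hS : Φ.IsStationary μ)
    (hshift : ∀ x : V3, MeasurePreserving (spatialShift x) μ μ)
    {a b : MarkedConfig → ℝ} (ha : Measurable a) (hb : Measurable b) (ha2 : MemLp a 2 μ) (hb2 : MemLp b 2 μ)
    (t R : ℝ) :
    Integrable (fun x : V3 => cov[a, (b ∘ Φ.flow t) ∘ spatialShift x; μ]) volume ↔
      IntegrableOn (fun x : V3 => cov[a, (b ∘ Φ.flow t) ∘ spatialShift x; μ]) (Metric.closedBall (0 : V3) R)ᶜ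
        volume :=
  integrable_cov_comp_spatialShift_iff hshift ha (hb.comp (Φ.measurable_flow t)) ha2
    (hb2.comp_measurePreserving (hS.measurePreserving t)) R

/-- **The equal-time case is static**: if the flow is `μ`-a.e. defined (`Φ_0 = id` a.e.) and the shifts preserve
`μ`, then `Cov_μ(a, (b ∘ Φ_0) ∘ τ_x) = Cov_μ(a, b ∘ τ_x)` for every `x` — the `t = 0` instance of the stub is the
spatial clustering of the state alone. [folklore] -/
theorem cov_flow_zero_spatialShift {σ : ℝ} (Φ : InfiniteHardSphereFlow (Fin 3) σ)
    {μ : Measure MarkedConfig} (hD : Φ.IsAEDefined μ) (hshift : ∀ x : V3, MeasurePreserving (spatialShift x) μ μ)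
    (a b : MarkedConfig → ℝ) (x : V3) :
    cov[a, (b ∘ Φ.flow 0) ∘ spatialShift x; μ] = cov[a, b ∘ spatialShift x; μ] := by
  have h0 : b ∘ Φ.flow 0 =ᵐ[μ] b := by
    filter_upwards [Φ.flow_zero_ae hD] with ω hω
    change b (Φ.flow 0 ω) = b ω
    rw [hω, id_eq]
  have hx : (b ∘ Φ.flow 0) ∘ spatialShift x =ᵐ[μ] b ∘ spatialShift x :=
    (hshift x).quasiMeasurePreserving.ae_eq_comp h0
  exact covariance_congr_ae (Filter.EventuallyEq.refl _ _) hx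

/-- **Equal-time reduction for a Gibbs state**: for an equilibrium flow `Φ` and a translation-invariant hard-sphere
Gibbs state `μ` at `(σ, z, θ⁻¹)` (`z, θ > 0`), the `t = 0` clustering integrand of the stub is the static truncated
two-point function `x ↦ Cov_μ(a, b ∘ τ_x)`, so its integrability is a property of the state alone. [folklore] -/
theorem integrable_cov_flow_zero_spatialShift_iff {σ θ z : ℝ} (hθ : 0 < θ) (hz : 0 < z)
    {Φ : InfiniteHardSphereFlow (Fin 3) σ} (hΦ : Φ.IsEquilibriumFlow) {μ : Measure MarkedConfig}
    (hG : IsHardSphereGibbs σ z θ⁻¹ (0 : V3) μ) (hti : IsTranslationInvariant μ) (a b : MarkedConfig → ℝ) :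
    Integrable (fun x : V3 => cov[a, (b ∘ Φ.flow 0) ∘ spatialShift x; μ]) volume ↔
      Integrable (fun x : V3 => cov[a, b ∘ spatialShift x; μ]) volume := by
  have hD : Φ.IsAEDefined μ := (hΦ z θ⁻¹ hz (inv_pos.2 hθ) μ hG).1
  have hshift : ∀ x : V3, MeasurePreserving (spatialShift x) μ μ := fun x =>
    ⟨PointConfig.measurable_translate _, hti x⟩
  have e : (fun x : V3 => cov[a, (b ∘ Φ.flow 0) ∘ spatialShift x; μ]) =
      fun x : V3 => cov[a, b ∘ spatialShift x; μ] :=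
    funext fun x => cov_flow_zero_spatialShift Φ hD hshift a b x
  rw [e]

/-- The six generators (five cell charges and the cell shear stress) are measurable. [folklore] -/
theorem measurable_of_mem_generators :
    ∀ a ∈ Set.range cellCharge ∪ {cellObs fun v : V3 => v 0 * v 1}, Measurable a := by
  rintro a (⟨i, rfl⟩ | ha)
  · exact measurable_cellCharge i
  · rw [Set.mem_singleton_iff] at ha
    rw [ha]
    exact measurable_cellObs (by fun_prop : Continuous fun v : V3 => v 0 * v 1).measurable

/-- **Reduction of the registered stub `stub_twoTimeClustering` to a decay estimate at spatial infinity**: the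
registered signature (two-time spatial clustering of the six generators under every translation-invariant
density-one hard-sphere Gibbs state and every equilibrium flow, for small reduced diameter) follows verbatim from
the existence, for each admissible `(σ, Φ, θ, z, μ, a, b, t)`, of an integrable majorant of
`|Cov_μ(a, (b ∘ Φ_t) ∘ τ_x)|` off some ball — all measurability (`measurable_cov_comp_spatialShift`), square
integrability (`memLp_generators_of_isHardSphereGibbs`, stationarity of `Φ` in the Gibbs state) and local
integrability (Cauchy–Schwarz) being discharged here.  The majorant is the open analytic content (Spohn 1991
Part I (7.6)/(7.14): "the truncated correlations decay"). [folklore] -/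
theorem twoTimeClustering_of_decay :
    (∃ σ₃ : ℝ, 0 < σ₃ ∧ ∀ σ : ℝ, 0 < σ → σ < σ₃ → ∀ Φ : InfiniteHardSphereFlow (Fin 3) σ,
      Φ.IsEquilibriumFlow → ∀ θ z : ℝ, 0 < θ → 0 < z →
      ∀ μ : Measure MarkedConfig, IsHardSphereGibbs σ z θ⁻¹ (0 : V3) μ → IsTranslationInvariant μ →
        PointProcess.density μ = 1 →
        ∀ a ∈ Set.range cellCharge ∪ {cellObs fun v : V3 => v 0 * v 1},
        ∀ b ∈ Set.range cellCharge ∪ {cellObs fun v : V3 => v 0 * v 1}, ∀ t : ℝ,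
          ∃ g : V3 → ℝ, Integrable g volume ∧ ∃ R : ℝ, ∀ x : V3, R ≤ ‖x‖ →
            |cov[a, (b ∘ Φ.flow t) ∘ spatialShift x; μ]| ≤ g x) →
    ∃ σ₃ : ℝ, 0 < σ₃ ∧ ∀ σ : ℝ, 0 < σ → σ < σ₃ → ∀ Φ : InfiniteHardSphereFlow (Fin 3) σ,
      Φ.IsEquilibriumFlow → ∀ θ z : ℝ, 0 < θ → 0 < z →
      ∀ μ : Measure MarkedConfig, IsHardSphereGibbs σ z θ⁻¹ (0 : V3) μ → IsTranslationInvariant μ →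
        PointProcess.density μ = 1 →
        ∀ a ∈ Set.range cellCharge ∪ {cellObs fun v : V3 => v 0 * v 1},
        ∀ b ∈ Set.range cellCharge ∪ {cellObs fun v : V3 => v 0 * v 1}, ∀ t : ℝ,
          Integrable (fun x : V3 => cov[a, (b ∘ Φ.flow t) ∘ spatialShift x; μ]) volume := by
  rintro ⟨σ₃, hσ₃, H⟩
  refine ⟨σ₃, hσ₃, fun σ hσ hσ' Φ hΦ θ z hθ hz μ hG hti hρ a ha b hb t => ?_⟩
  obtain ⟨g, hg, R, hR⟩ := H σ hσ hσ' Φ hΦ θ z hθ hz μ hG hti hρ a ha b hb t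
  haveI : IsProbabilityMeasure μ := hG.1
  have hS : Φ.IsStationary μ := (hΦ z θ⁻¹ hz (inv_pos.2 hθ) μ hG).2
  have hshift : ∀ x : V3, MeasurePreserving (spatialShift x) μ μ := fun x =>
    ⟨PointConfig.measurable_translate _, hti x⟩
  have hL2 := memLp_generators_of_isHardSphereGibbs σ θ z hσ hθ hz μ hG
  exact integrable_cov_flow_spatialShift_of_decay Φ hS hshift (measurable_of_mem_generators a ha)
    (measurable_of_mem_generators b hb) (hL2 a ha) (hL2 b hb) t hg hR

/-- **Tail form of the registered stub at one admissible datum**: for `σ, θ, z > 0`, an equilibrium flow `Φ`, a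
translation-invariant hard-sphere Gibbs state `μ` at `(σ, z, θ⁻¹)`, two generators `a, b`, a time `t` and any radius
`R`, the clustering integral of `stub_twoTimeClustering` converges iff it converges off the ball `B̄(0, R)` (no
smallness of `σ` and no density hypothesis are needed for this equivalence). [folklore] -/
theorem integrable_cov_generators_iff_tail {σ θ z : ℝ} (hσ : 0 < σ) (hθ : 0 < θ) (hz : 0 < z)
    {Φ : InfiniteHardSphereFlow (Fin 3) σ} (hΦ : Φ.IsEquilibriumFlow) {μ : Measure MarkedConfig}
    (hG : IsHardSphereGibbs σ z θ⁻¹ (0 : V3) μ) (hti : IsTranslationInvariant μ)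
    {a : MarkedConfig → ℝ} (ha : a ∈ Set.range cellCharge ∪ {cellObs fun v : V3 => v 0 * v 1})
    {b : MarkedConfig → ℝ} (hb : b ∈ Set.range cellCharge ∪ {cellObs fun v : V3 => v 0 * v 1}) (t R : ℝ) :
    Integrable (fun x : V3 => cov[a, (b ∘ Φ.flow t) ∘ spatialShift x; μ]) volume ↔
      IntegrableOn (fun x : V3 => cov[a, (b ∘ Φ.flow t) ∘ spatialShift x; μ]) (Metric.closedBall (0 : V3) R)ᶜ
        volume := by
  haveI : IsProbabilityMeasure μ := hG.1
  have hS : Φ.IsStationary μ := (hΦ z θ⁻¹ hz (inv_pos.2 hθ) μ hG).2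
  have hshift : ∀ x : V3, MeasurePreserving (spatialShift x) μ μ := fun x =>
    ⟨PointConfig.measurable_translate _, hti x⟩
  have hL2 := memLp_generators_of_isHardSphereGibbs σ θ z hσ hθ hz μ hG
  exact integrable_cov_flow_spatialShift_iff Φ hS hshift (measurable_of_mem_generators a ha)
    (measurable_of_mem_generators b hb) (hL2 a ha) (hL2 b hb) t R

end Summit.AtomisticToContinuum.HydrodynamicLimit.Theorems.MourreKoopmanChargesStressStrongMixing

end
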